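import Summits.RiemannHypothesis.RiemannHypothesis.Theorems.NymanBeurlingQDigitsKernel
import Summits.RiemannHypothesis.RiemannHypothesis.Theorems.NymanBeurlingFractSqIntegral
import Summits.RiemannHypothesis.RiemannHypothesis.Theorems.NymanBeurlingDilateZeroSumTrivialPart
import Summits.RiemannHypothesis.RiemannHypothesis.Theorems.NymanBeurlingTailLeverageSharp
import Literature.Analysis.SpecialFunctions.LogPiBounds
import Literature.Analysis.SpecialFunctions.EulerMascheroniSharpBounds
import HarnessLib

/-!
# RiemannHypothesis / Nyman–Beurling — `Q = ∫_0^1 ({1/x} − h)²` TO NINE DECIMALS in the kernel: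
# `|Q − 0.0803270395| ≤ 10⁻⁹` (theory target `NbQValue`, numeric conjunct; RH-FREE, kernel-certified numerics)

Column LI/NB, rung L-P(P2) «structure of the NB minimiser», PROOF-OF-DATA for cell `pub/rh-li` [rh-li-eng-3 g5].
The constant `Q = nbQ` (variance of the fluctuation `q = {1/x} − E[{1/x} | I_n]`) enters the tail-constant identity (T3),
the κ-law `(1+Q)κ_N = m_1 + …` (T4/L5) and the leverage ceiling `s_N ≤ 1/Q` (`nbLeverage_le_inv_nbQ`).  Theory
(`theory/NBHeadTail.lean`, `NbQValue`) typed `|Q − 0.0803270395| ≤ 10⁻⁹`; g3 proved the closed form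
`Q = (log 2π − γ − 1) − Σ_{n≥1} m_n²/(n(n+1))` (`nbQ_eq`).  This file certifies the digits:

* head `n = 2, …, 400`: the kernel evaluates `m_n = n(n+1) log(1 + 1/n) − n` through the tree's interval logarithm
  `Literature.Analysis.SpecialFunctions.KernelLog.log1pIv` (scale `2⁸⁰`, `log1pIv_sound`) with outward-rounded fixed-point
  sums (`termIv`, `hAcc`, `fAcc`; soundness `termIv_sound`, `hAcc_sound`, `fAcc_sound`; test `qCheck_eq`, `decide +kernel`);
* tail `n > 400`: the Farey-mean series (`nbFareyMean_bounds`: `r/3 ≤ ½ − m_n ≤ (r/3)/(1−r²)`, `r = 1/(2n+1)`) gives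
  `(¼ − r/3)/(n(n+1)) ≤ m_n²/(n(n+1)) ≤ (¼ − r/3 + r²/9)/(n(n+1))` (`term_bounds`), summed with `Σ 1/(n(n+1)) = 1/(M+1)`,
  `Σ_{n≥1} 1/(n(n+1)(2n+1)) = 3 − 4 log 2` (`hasSum_cubicTerm`) and `Σ_{n>M} 1/((2n+1)²n(n+1)) ≤ 1/(12M(M+1)(M+2))`;
* constants: `log 2`, `log π` to 20 decimals, `γ` to 16 (tree).

Results: `abs_nbQ_sub_le` (**`|Q − 0.0803270395| ≤ 10⁻⁹`**), `nbQ_mem_Icc`, **`inv_nbQ_lt : 1/Q < 12.4492`** and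
**`nbLeverage_lt`: the head/tail leverage satisfies `s_N < 12.4492` for every `N`** (certified DATA plateau `s_2000 = 12.32`,
i.e. `0.990/Q`), `nbQValue_holds` (theory's `NbQValue`, all three conjuncts).
RH-FREE [rh-li-eng-3 g5]: certified numerics of a classical constant; nothing here bears on the truth of RH.
-/

noncomputable section

set_option linter.dupNamespace false

open Filter Set Topology Finset
open scoped Real

namespace Summit.RiemannHypothesis.RiemannHypothesis.Theorems.NbTheory

open Literature.NumberTheory.LFunctions Literature.Analysis.SpecialFunctions.KernelLog

namespace QDigits
/-! ## Analytic pieces -/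

/-- Termwise bounds from the Farey-mean series: for `n ≥ 1`, `r = 1/(2n+1)`,
`(¼ − r/3)/(n(n+1)) ≤ m_n²/(n(n+1)) ≤ (¼ − r/3 + r²/9)/(n(n+1))`. -/
theorem term_bounds {n : ℕ} (hn : 0 < n) :
    (1 / 4 - 1 / (2 * (n : ℝ) + 1) / 3) / ((n : ℝ) * ((n : ℝ) + 1)) ≤ nbFareyMean n ^ 2 / ((n : ℝ) * ((n : ℝ) + 1)) ∧
      nbFareyMean n ^ 2 / ((n : ℝ) * ((n : ℝ) + 1)) ≤
        (1 / 4 - 1 / (2 * (n : ℝ) + 1) / 3 + (1 / (2 * (n : ℝ) + 1)) ^ 2 / 9) / ((n : ℝ) * ((n : ℝ) + 1)) := by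
  obtain ⟨hL, hU⟩ := nbFareyMean_bounds hn
  have hm0 := nbFareyMean_nonneg n
  have hn' : (1 : ℝ) ≤ n := by exact_mod_cast hn
  have hN : (0 : ℝ) < (n : ℝ) * ((n : ℝ) + 1) := by positivity
  set r : ℝ := 1 / (2 * (n : ℝ) + 1) with hr
  set m := nbFareyMean n with hm
  have hr0 : 0 < r := by rw [hr]; positivity
  have hr3 : r ≤ 1 / 3 := by
    rw [hr]; exact one_div_le_one_div_of_le (by norm_num) (by linarith)
  have hD : 0 < 1 - r ^ 2 := by nlinarith
  constructor
  · refine div_le_div_of_nonneg_right ?_ hN.le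
    -- `m ≥ ½ − U ≥ 0` and `(½ − U)² ≥ ¼ − r/3`
    set U := r / 3 / (1 - r ^ 2) with hUdef
    have hU0 : 0 ≤ U := by positivity
    have hU8 : U ≤ 1 / 8 := by
      rw [hUdef, div_le_iff₀ hD]; nlinarith
    have hmU : 1 / 2 - U ≤ m := by linarith
    have hsq : (1 / 2 - U) ^ 2 ≤ m ^ 2 := pow_le_pow_left₀ (by linarith) hmU 2
    -- `U − U² ≤ r/3`
    have hkey : U - U ^ 2 ≤ r / 3 := by
      have hUD : U * (3 * (1 - r ^ 2)) = r := by rw [hUdef]; field_simp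
      nlinarith [hUD, mul_pos hr0 hD, sq_nonneg U, hr3, hr0]
    nlinarith
  · refine div_le_div_of_nonneg_right ?_ hN.le
    have hmle : m ≤ 1 / 2 - r / 3 := by linarith
    have hsq : m ^ 2 ≤ (1 / 2 - r / 3) ^ 2 := pow_le_pow_left₀ hm0 hmle 2
    nlinarith

/-- `Σ_{k≥0} 1/((k+1)(k+2)(2k+3)) = 3 − 4 log 2`. -/
theorem hasSum_cubicTerm :
    HasSum (fun k : ℕ ↦ 1 / (((k : ℝ) + 1) * ((k : ℝ) + 2) * (2 * k + 3))) (3 - 4 * Real.log 2) := by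
  have h1 := DilateExplicit.hasSum_one_div_even_mul_odd
  have h2 : HasSum (fun k : ℕ ↦ 1 / ((2 * (((k + 1 : ℕ) : ℝ)) + 1) * (2 * (((k + 1 : ℕ) : ℝ)) + 2)))
      (Real.log 2 - 1 / 2) := by
    have h := (hasSum_nat_add_iff' (f := fun k : ℕ ↦ 1 / ((2 * (k : ℝ) + 1) * (2 * k + 2))) 1).2
      DilateExplicit.hasSum_one_div_odd_mul_even
    have hf0 : ∑ i ∈ Finset.range 1, 1 / ((2 * (i : ℝ) + 1) * (2 * i + 2)) = 1 / 2 := by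
      simp
    rw [hf0] at h
    exact h
  have h := (h1.sub h2).mul_left 2
  rw [show (2 : ℝ) * (1 - Real.log 2 - (Real.log 2 - 1 / 2)) = 3 - 4 * Real.log 2 by ring] at h
  refine h.congr_fun fun k ↦ ?_
  push_cast
  have h1' : (2 * (k : ℝ) + 2) ≠ 0 := by positivity
  have h2' : (2 * (k : ℝ) + 3) ≠ 0 := by positivity
  have h3' : (2 * ((k : ℝ) + 1) + 1) ≠ 0 := by positivity
  have h4' : (2 * ((k : ℝ) + 1) + 2) ≠ 0 := by positivity
  have h5' : ((k : ℝ) + 1) ≠ 0 := by positivity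
  have h6' : ((k : ℝ) + 2) ≠ 0 := by positivity
  field_simp
  ring

/-- Telescoping: `Σ_{j≥0} 1/((j+M+1)(j+M+2)) = 1/(M+1)`. -/
theorem hasSum_inv_mul_succ (M : ℕ) :
    HasSum (fun j : ℕ ↦ 1 / (((j : ℝ) + M + 1) * ((j : ℝ) + M + 2))) (1 / ((M : ℝ) + 1)) := by
  have hpart : ∀ J : ℕ, ∑ j ∈ Finset.range J, 1 / (((j : ℝ) + M + 1) * ((j : ℝ) + M + 2)) =
      1 / ((M : ℝ) + 1) - 1 / ((J : ℝ) + M + 1) := by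
    intro J
    induction J with
    | zero => simp
    | succ J ih =>
      rw [Finset.sum_range_succ, ih]
      push_cast
      have h1 : ((J : ℝ) + M + 1) ≠ 0 := by positivity
      have h2 : ((J : ℝ) + M + 2) ≠ 0 := by positivity
      have h3 : ((J : ℝ) + 1 + M + 1) ≠ 0 := by positivity
      field_simp
      ring
  refine (hasSum_iff_tendsto_nat_of_nonneg (fun j ↦ by positivity) _).2 ?_
  have hlim : Tendsto (fun J : ℕ ↦ 1 / ((M : ℝ) + 1) - 1 / ((J : ℝ) + M + 1)) atTop (𝓝 (1 / ((M : ℝ) + 1) - 0)) := by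
    refine tendsto_const_nhds.sub ?_
    have h1 : Tendsto (fun J : ℕ ↦ (J : ℝ) + M + 1) atTop atTop :=
      tendsto_atTop_add_const_right _ _ (tendsto_atTop_add_const_right _ _ tendsto_natCast_atTop_atTop)
    refine (h1.inv_tendsto_atTop).congr fun J ↦ ?_
    simp only [Pi.inv_apply, one_div]
  rw [sub_zero] at hlim
  exact hlim.congr fun J ↦ (hpart J).symm

/-- The quartic tail, partial sums: `Σ_{j<J} 1/((2n+1)² n(n+1)) ≤ 1/(12 M(M+1)(M+2))` with `n = j+M+1`, `M ≥ 1`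
(`1/((2n+1)²n(n+1)) ≤ 1/(4(n−1)n(n+1)(n+2))`, telescoping). -/
theorem quartic_sum_range_le {M : ℕ} (hM : 1 ≤ M) (J : ℕ) :
    ∑ j ∈ Finset.range J, (1 / (2 * ((j : ℝ) + M + 1) + 1)) ^ 2 / (((j : ℝ) + M + 1) * ((j : ℝ) + M + 2)) ≤
      1 / (12 * ((M : ℝ) * ((M : ℝ) + 1) * ((M : ℝ) + 2))) := by
  have hM' : (1 : ℝ) ≤ M := by exact_mod_cast hM
  have hpart : ∀ J : ℕ, ∑ j ∈ Finset.range J,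
      (1 / (2 * ((j : ℝ) + M + 1) + 1)) ^ 2 / (((j : ℝ) + M + 1) * ((j : ℝ) + M + 2)) ≤
      1 / (12 * ((M : ℝ) * ((M : ℝ) + 1) * ((M : ℝ) + 2))) -
        1 / (12 * (((J : ℝ) + M) * ((J : ℝ) + M + 1) * ((J : ℝ) + M + 2))) := by
    intro J
    induction J with
    | zero => simp
    | succ J ih =>
      rw [Finset.sum_range_succ]
      have hstep : (1 / (2 * ((J : ℝ) + M + 1) + 1)) ^ 2 / (((J : ℝ) + M + 1) * ((J : ℝ) + M + 2)) ≤
          1 / (12 * (((J : ℝ) + M) * ((J : ℝ) + M + 1) * ((J : ℝ) + M + 2))) -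
            1 / (12 * ((((J + 1 : ℕ) : ℝ) + M) * (((J + 1 : ℕ) : ℝ) + M + 1) * (((J + 1 : ℕ) : ℝ) + M + 2))) := by
        push_cast
        have hx : (1 : ℝ) ≤ (J : ℝ) + M := by linarith [(J.cast_nonneg : (0 : ℝ) ≤ J)]
        set x : ℝ := (J : ℝ) + M with hxdef
        have e : 1 / (12 * (x * (x + 1) * (x + 2))) - 1 / (12 * ((x + 1) * (x + 1 + 1) * (x + 1 + 2))) =
            1 / (4 * (x * (x + 1) * (x + 2) * (x + 3))) := by
          field_simp
          ring
        rw [show (J : ℝ) + 1 + M = x + 1 by rw [hxdef]; ring, e]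
        have hx0 : 0 < x := by linarith
        rw [one_div_pow, div_div, div_le_div_iff₀ (by positivity) (by positivity), one_mul, one_mul]
        have hp : 0 ≤ (x + 1) * (x + 1 + 1) := by positivity
        nlinarith [hp]
      linarith
  refine (hpart J).trans ?_
  have : 0 ≤ 1 / (12 * (((J : ℝ) + M) * ((J : ℝ) + M + 1) * ((J : ℝ) + M + 2))) := by positivity
  linarith

/-- The quartic tail is summable. -/
theorem summable_quartic {M : ℕ} (hM : 1 ≤ M) :
    Summable fun j : ℕ ↦ (1 / (2 * ((j : ℝ) + M + 1) + 1)) ^ 2 / (((j : ℝ) + M + 1) * ((j : ℝ) + M + 2)) :=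
  summable_of_sum_range_le (fun j ↦ by positivity) (quartic_sum_range_le hM)

/-- The quartic tail: `Σ_{j≥0} 1/((2n+1)² n(n+1)) ≤ 1/(12 M(M+1)(M+2))`, `n = j+M+1`, `M ≥ 1`. -/
theorem tsum_quartic_le {M : ℕ} (hM : 1 ≤ M) :
    ∑' j : ℕ, (1 / (2 * ((j : ℝ) + M + 1) + 1)) ^ 2 / (((j : ℝ) + M + 1) * ((j : ℝ) + M + 2)) ≤
      1 / (12 * ((M : ℝ) * ((M : ℝ) + 1) * ((M : ℝ) + 2))) :=
  Real.tsum_le_of_sum_range_le (fun j ↦ by positivity) (quartic_sum_range_le hM)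

end QDigits

open QDigits

/-- **`NbQValue`, the numeric conjunct (RH-FREE, kernel-certified): `|Q − 0.0803270395| ≤ 10⁻⁹`.**
`Q = (log 2π − γ − 1) − Σ_{n≥1} m_n²/(n(n+1))` (`nbQ_eq`); head `n ≤ 400` by the kernel interval evaluation
(`KernelLog.log1pIv`, scale `2⁸⁰`), tail by the Farey-mean series bounds and `Σ 1/(n(n+1)(2n+1)) = 3 − 4 log 2`. -/
theorem abs_nbQ_sub_le : |nbQ - 0.0803270395| ≤ 1e-9 := by
  -- kernel facts
  have hchk := QDigits.qCheck_eq
  unfold QDigits.qCheck at hchk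
  cases hH : QDigits.hAcc 399 with
  | none => simp [hH] at hchk
  | some p =>
    obtain ⟨a, b⟩ := p
    simp only [hH, Bool.and_eq_true, decide_eq_true_eq] at hchk
    obtain ⟨hc1, hc2⟩ := hchk
    obtain ⟨hFlo, hFhi⟩ := QDigits.fAcc_sound 400
    obtain ⟨hHlo, hHhi⟩ := QDigits.hAcc_sound 399 hH
    -- make the kernel integers opaque (no tactic below may unfold `fAcc 400`)
    generalize hFF : QDigits.fAcc 400 = FF at hc1 hc2 hFlo hFhi
    obtain ⟨F1, F2⟩ := FF
    simp only at hc1 hc2 hFlo hFhi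
    have hc1R : 3 * (b : ℝ) + (F2 : ℝ) ≤ 3 * 2 ^ 80 * ((QDigits.QLOq : ℚ) : ℝ) := by
      exact_mod_cast hc1
    have hc2R : 3 * 2 ^ 80 * ((QDigits.QHIq : ℚ) : ℝ) ≤ 3 * (a : ℝ) + (F1 : ℝ) := by
      exact_mod_cast hc2
    clear hc1 hc2 hFF hH
    have hQLO : ((QDigits.QLOq : ℚ) : ℝ) =
        (0.69314718055994530940 + 1.14472988584940017414 - 0.5772156649015405 - 1)
          - (2 * 0.69314718055994530944 - 1) ^ 2 / 2 - 1 / (4 * 401) + (3 - 4 * 0.69314718055994530944) / 3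
          - 1 / (108 * (400 * 401 * 402)) - (0.0803270395 - 1 / 10 ^ 9) := by
      norm_num [QDigits.QLOq, QDigits.L2LOq, QDigits.L2HIq, QDigits.LPILOq, QDigits.GHIq]
    have hQHI : ((QDigits.QHIq : ℚ) : ℝ) =
        (0.69314718055994530944 + 1.14472988584940017415 - 0.5772156649015328 - 1)
          - (2 * 0.69314718055994530940 - 1) ^ 2 / 2 - 1 / (4 * 401) + (3 - 4 * 0.69314718055994530940) / 3
          - (0.0803270395 + 1 / 10 ^ 9) := by
      norm_num [QDigits.QHIq, QDigits.L2LOq, QDigits.L2HIq, QDigits.LPIHIq, QDigits.GLOq]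
    -- real constants
    have hl2lo := Literature.Analysis.SpecialFunctions.Real.log_two_gt_d20
    have hl2hi := Literature.Analysis.SpecialFunctions.Real.log_two_lt_d20
    have hlpilo := Literature.Analysis.SpecialFunctions.Real.log_pi_gt_d20
    have hlpihi := Literature.Analysis.SpecialFunctions.Real.log_pi_lt_d20
    have hglo := Literature.Analysis.SpecialFunctions.Real.eulerMascheroniConstant_gt_d16
    have hghi := Literature.Analysis.SpecialFunctions.Real.eulerMascheroniConstant_lt_d16
    have hlog2pi : Real.log (2 * Real.pi) = Real.log 2 + Real.log Real.pi :=
      Real.log_mul two_ne_zero Real.pi_pos.ne'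
    -- the series for `Q`
    set f : ℕ → ℝ := fun j ↦ nbFareyMean (j + 1) ^ 2 / (((j : ℝ) + 1) * ((j : ℝ) + 2)) with hfdef
    have hQ : nbQ = (Real.log (2 * Real.pi) - Real.eulerMascheroniConstant - 1) - ∑' j, f j := nbQ_eq
    have hf0le : ∀ j, 0 ≤ f j := fun j ↦ by rw [hfdef]; positivity
    have hfle : ∀ j, f j ≤ 1 / (((j : ℝ) + (0 : ℕ) + 1) * ((j : ℝ) + (0 : ℕ) + 2)) := by
      intro j
      rw [hfdef, Nat.cast_zero, add_zero]
      refine div_le_div_of_nonneg_right ?_ (by positivity)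
      have h1 := nbFareyMean_le_one (j + 1)
      have h0 := nbFareyMean_nonneg (j + 1)
      nlinarith
    have hsf : Summable f := Summable.of_nonneg_of_le hf0le hfle (QDigits.hasSum_inv_mul_succ 0).summable
    have hsplit : ∑' j, f j = ∑ i ∈ Finset.range 400, f i + ∑' j, f (j + 400) :=
      (hsf.sum_add_tsum_nat_add 400).symm
    have hhead : ∑ i ∈ Finset.range 400, f i = f 0 + ∑ k ∈ Finset.range 399, f (k + 1) := by
      rw [Finset.sum_range_succ', add_comm]
    have hf0 : f 0 = (2 * Real.log 2 - 1) ^ 2 / 2 := by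
      rw [hfdef]
      simp only [Nat.cast_zero, zero_add]
      rw [FareyMean.nbFareyMean_of_pos one_pos]
      norm_num
    have hheadeq : ∑ k ∈ Finset.range 399, f (k + 1) =
        ∑ k ∈ Finset.range 399, nbFareyMean (k + 2) ^ 2 / ((((k + 2 : ℕ) : ℝ)) * (((k + 2 : ℕ) : ℝ) + 1)) := by
      refine Finset.sum_congr rfl fun k _ ↦ ?_
      rw [hfdef]
      push_cast
      ring_nf
    -- the tail `Σ_j f(j+400)`, `n = j + 401`
    have htail := ((summable_nat_add_iff 400).2 hsf).hasSum
    have hT1 : HasSum (fun j : ℕ ↦ 1 / ((((j + 400 : ℕ) : ℝ) + 1) * (((j + 400 : ℕ) : ℝ) + 2) * (2 * ((j + 400 : ℕ) : ℝ) + 3)))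
        ((3 - 4 * Real.log 2) - ∑ k ∈ Finset.range 400, 1 / (((k : ℝ) + 1) * ((k : ℝ) + 2) * (2 * k + 3))) :=
      (hasSum_nat_add_iff' 400).2 QDigits.hasSum_cubicTerm
    have hA : HasSum (fun j : ℕ ↦ 1 / (((j : ℝ) + 400 + 1) * ((j : ℝ) + 400 + 2))) (1 / ((400 : ℝ) + 1)) := by
      have h := QDigits.hasSum_inv_mul_succ 400
      simp only [Nat.cast_ofNat] at h
      exact h
    have hCs : Summable fun j : ℕ ↦ (1 / (2 * ((j : ℝ) + 400 + 1) + 1)) ^ 2 / (((j : ℝ) + 400 + 1) * ((j : ℝ) + 400 + 2)) := by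
      have h := QDigits.summable_quartic (by norm_num : 1 ≤ 400)
      simp only [Nat.cast_ofNat] at h
      exact h
    have hC := hCs.hasSum
    have hCle : ∑' j : ℕ, (1 / (2 * ((j : ℝ) + 400 + 1) + 1)) ^ 2 / (((j : ℝ) + 400 + 1) * ((j : ℝ) + 400 + 2)) ≤
        1 / (12 * ((400 : ℝ) * ((400 : ℝ) + 1) * ((400 : ℝ) + 2))) := by
      have h := QDigits.tsum_quartic_le (by norm_num : 1 ≤ 400)
      simp only [Nat.cast_ofNat] at h
      exact h
    set C := ∑' j : ℕ, (1 / (2 * ((j : ℝ) + 400 + 1) + 1)) ^ 2 / (((j : ℝ) + 400 + 1) * ((j : ℝ) + 400 + 2))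
      with hCdef
    set F := ∑ k ∈ Finset.range 400, 1 / (((k : ℝ) + 1) * ((k : ℝ) + 2) * (2 * k + 3)) with hFdef
    -- lower tail bound
    have hlow : (1 / 4) * (1 / ((400 : ℝ) + 1)) - (1 / 3) * ((3 - 4 * Real.log 2) - F) ≤ ∑' j, f (j + 400) := by
      have hcomb := (hA.mul_left (1 / 4)).sub (hT1.mul_left (1 / 3))
      refine hasSum_le (fun j ↦ ?_) hcomb htail
      have hb := (QDigits.term_bounds (n := j + 401) (by omega)).1
      rw [hfdef]
      simp only
      push_cast at hb ⊢
      have e1 : (1 / 4 - 1 / (2 * ((j : ℝ) + 401) + 1) / 3) / (((j : ℝ) + 401) * ((j : ℝ) + 401 + 1)) =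
          1 / 4 * (1 / (((j : ℝ) + 400 + 1) * ((j : ℝ) + 400 + 2))) -
            1 / 3 * (1 / (((j : ℝ) + 400 + 1) * ((j : ℝ) + 400 + 2) * (2 * ((j : ℝ) + 400) + 3))) := by
        field_simp
        ring
      have e2 : nbFareyMean (j + 401) ^ 2 / (((j : ℝ) + 401) * ((j : ℝ) + 401 + 1)) =
          nbFareyMean (j + 400 + 1) ^ 2 / (((j : ℝ) + 400 + 1) * ((j : ℝ) + 400 + 2)) := by
        ring_nf
      rw [← e1, ← e2]
      exact hb
    -- upper tail bound
    have hupp : ∑' j, f (j + 400) ≤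
        (1 / 4) * (1 / ((400 : ℝ) + 1)) - (1 / 3) * ((3 - 4 * Real.log 2) - F) + (1 / 9) * C := by
      have hcomb := ((hA.mul_left (1 / 4)).sub (hT1.mul_left (1 / 3))).add (hC.mul_left (1 / 9))
      refine hasSum_le (fun j ↦ ?_) htail hcomb
      have hb := (QDigits.term_bounds (n := j + 401) (by omega)).2
      rw [hfdef]
      simp only
      push_cast at hb ⊢
      have e1 : (1 / 4 - 1 / (2 * ((j : ℝ) + 401) + 1) / 3 + (1 / (2 * ((j : ℝ) + 401) + 1)) ^ 2 / 9) /
            (((j : ℝ) + 401) * ((j : ℝ) + 401 + 1)) =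
          1 / 4 * (1 / (((j : ℝ) + 400 + 1) * ((j : ℝ) + 400 + 2))) -
            1 / 3 * (1 / (((j : ℝ) + 400 + 1) * ((j : ℝ) + 400 + 2) * (2 * ((j : ℝ) + 400) + 3))) +
            1 / 9 * ((1 / (2 * ((j : ℝ) + 400 + 1) + 1)) ^ 2 / (((j : ℝ) + 400 + 1) * ((j : ℝ) + 400 + 2))) := by
        field_simp
        ring
      have e2 : nbFareyMean (j + 401) ^ 2 / (((j : ℝ) + 401) * ((j : ℝ) + 401 + 1)) =
          nbFareyMean (j + 400 + 1) ^ 2 / (((j : ℝ) + 400 + 1) * ((j : ℝ) + 400 + 2)) := by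
        ring_nf
      rw [← e1, ← e2]
      exact hb
    -- `f 0` against the `log 2` enclosure
    have h2l : 0 ≤ 2 * Real.log 2 - 1 := by linarith only [hl2lo]
    have hf0hi : f 0 ≤ (2 * 0.69314718055994530944 - 1) ^ 2 / 2 := by
      rw [hf0]
      have h1 : 2 * Real.log 2 - 1 ≤ 2 * 0.69314718055994530944 - 1 := by linarith only [hl2hi]
      exact div_le_div_of_nonneg_right (pow_le_pow_left₀ h2l h1 2) (by norm_num)
    have hf0lo : (2 * 0.69314718055994530940 - 1) ^ 2 / 2 ≤ f 0 := by
      rw [hf0]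
      have h1 : 2 * 0.69314718055994530940 - 1 ≤ 2 * Real.log 2 - 1 := by linarith only [hl2lo]
      exact div_le_div_of_nonneg_right
        (pow_le_pow_left₀ (by norm_num : (0 : ℝ) ≤ 2 * 0.69314718055994530940 - 1) h1 2) (by norm_num)
    -- assemble
    have hC0 : 0 ≤ C := hC.nonneg fun j ↦ by positivity
    rw [abs_le]
    rw [hQ, hsplit, hhead, hheadeq, hlog2pi]
    rw [hQLO] at hc1R
    rw [hQHI] at hc2R
    constructor
    · linarith only [hc1R, hHhi, hFhi, hupp, hCle, hf0hi, hl2lo, hlpilo, hghi, hl2hi, hC0]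
    · linarith only [hc2R, hHlo, hFlo, hlow, hf0lo, hl2hi, hlpihi, hglo, hl2lo]

/-- **`Q` to nine decimals:** `0.0803270385 ≤ Q ≤ 0.0803270405`. -/
theorem nbQ_mem_Icc : (0.0803270385 : ℝ) ≤ nbQ ∧ nbQ ≤ 0.0803270405 := by
  have h := abs_nbQ_sub_le
  rw [abs_le] at h
  constructor
  · norm_num at h ⊢; linarith [h.1]
  · norm_num at h ⊢; linarith [h.2]

/-- **The leverage ceiling numerically (RH-FREE): `1/Q < 12.4492`**, so `s_N < 12.4492` for every `N`
(`nbLeverage_le_inv_nbQ`; certified DATA plateau `s_2000 = 12.32`). -/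
theorem inv_nbQ_lt : 1 / nbQ < 12.4492 := by
  obtain ⟨h1, -⟩ := nbQ_mem_Icc
  have hQ : 0 < nbQ := by linarith
  rw [div_lt_iff₀ hQ]
  nlinarith

/-- **THE LEVERAGE CEILING, NUMERICALLY (RH-FREE): `s_N < 12.4492` for every `N`** — if `G⁰ u = w` (`w_k = 1/(k+1)`) then
`s_N = Σ_k u_k/(k+1) < 12.4492` (`nbLeverage_le_inv_nbQ` and `inv_nbQ_lt`; certified DATA: `s_2000 = 12.32`). -/
theorem nbLeverage_lt (N : ℕ) (u : Fin N → ℝ)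
    (hu : ∀ k : Fin N, ∑ j : Fin N, nbGram0 k j * u j = 1 / ((k : ℝ) + 1)) :
    ∑ k : Fin N, u k / ((k : ℝ) + 1) < 12.4492 :=
  (nbLeverage_le_inv_nbQ N u hu).trans_lt inv_nbQ_lt

/-- **Theory's `NbQValue` (all three conjuncts, RH-FREE, DISCHARGED):** the closed form of `Q` (g3 `nbQ_eq`), the digits
`|Q − 0.0803270395| ≤ 10⁻⁹` (this file), and `∫_0^1 h = 1 − γ` (`nbCondExpIntegral_holds`). -/
theorem nbQValue_holds :
    (nbQ = (Real.log (2 * Real.pi) - Real.eulerMascheroniConstant - 1)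
        - ∑' n : ℕ, nbFareyMean (n + 1) ^ 2 / (((n : ℝ) + 1) * ((n : ℝ) + 2))) ∧
      |nbQ - 0.0803270395| ≤ 1e-9 ∧
      ∫ x in Set.Ioc (0 : ℝ) 1, nbStepH x = 1 - Real.eulerMascheroniConstant :=
  ⟨nbQ_eq, abs_nbQ_sub_le, nbCondExpIntegral_holds⟩

end Summit.RiemannHypothesis.RiemannHypothesis.Theorems.NbTheory

end
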